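import Mathlib
import Summits.ResolutionOfSingularities.ResolutionOfSingularities.Theorems.HomologicalConductorPersistenceKC3Tower
import HarnessLib

/-!
# The K-C3 TOWER STEP, part 2: the instance `T₁ = W_loc` for `A = k[x, z, t, (z³+t⁴)/x]` and the `x`-chart
# `W = k[x, z, t, z²/x, zt/x, t²/x, z³/x²]` (crux `Persistence`, stmt-ResolutionOfSingularities-16484; chain W4.4b K-C3 §H2L, object K3b)

Route `ResolutionOfSingularities/HomologicalConductor` (cell res-hironaka; seat res-D-pv-043; res-L1-w44b-plan-1 OBJECTS FOR THE IDLE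
POOL 2026-08-27T11:15:05Z «K3b», res-plan-2 DEAL #7v; spec of record = res-L1-w44b-tri-1's REFEREE-KC3 934cc3b7642bc99f L3–L6).
OURS; AI-written, weaker than expert review; nothing here is a statement of the manuscript under study (Hironaka 2017), and no
statement of it is used. No theorem here concludes the crux; the two hypotheses `hca` and `hnrm` below are exactly the inputs the
chain still owes (F-DP + U2 for `hca`; normality of the μ₆(1,2,3)-quotient chart for `hnrm`).

SETTING (all inside an ambient field `K ⊇ k`; `x, z, t : K`, `x ≠ 0`; `O` a valuation subring of `K` — in the chain `K = k(x,z,t)`,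
`O = O_w` the monomial valuation ring of weights `(6, 4+N, 3+N)`, object K3a; here `O` is a PARAMETER and the only valuation input used
is `W ⊆ O`, i.e. `x, z, t, z²/x, zt/x, t²/x, z³/x² ∈ O`): `A := k[x, z, t, y]`, `y := (z³ + t⁴)·x⁻¹` (the hypersurface `xy = z³ + t⁴`);
`T₀ := loc O A`; `W := k[x, z, t, z²x⁻¹, ztx⁻¹, t²x⁻¹, z³x⁻²]` (`= k[a⁶, a⁴b, a³c, a²b², abc, c², b³]` under `x = a⁶, z = a⁴b, t = a³c`);
the «I-image» `I·T₀ := {αx + βy + γz² + δzt + εt² : α, …, ε ∈ T₀} ⊆ K`.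

* `adjoin_A_le_W` (`y = z·(z²/x) + t²·(t²/x)`), `gens_div_x_mem_W` (`I/x ⊆ W`), `combination_div_x_mem_locW` (`I·T₀ ⊆ x·W_loc`);
* `W_le_chart` (L4 lower half): `ca T₀ = I·T₀` ⇒ `x ∈ ca T₀` is nonzero of MINIMAL VALUE (`c′x⁻¹ ∈ W_loc ⊆ O` for every `c′ ∈ ca T₀` —
  this is where `W ⊆ O` enters) ⇒ `z²/x, zt/x, t²/x, y/x ∈ chart O T₀` and `z³/x² = y/x − (t²/x)²`, so `W ≤ chart O T₀`;
* `chart_le_locW` (L3 + L4 upper half, valuation-free): a qualifying `x′` has `w′ := x′x⁻¹ ∈ W_loc` with `w′⁻¹ = x x′⁻¹ ∈ O`, hence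
  `w′⁻¹ ∈ W_loc` (`inv_mem_loc`), and `c x′⁻¹ = (c x⁻¹)·w′⁻¹ ∈ W_loc`;
* `kc3_tower_one_eq`: with `hnrm : nrm (loc O W) ≤ loc O W` (L5), part 1's sandwich gives **`tower O A 1 = loc O W`** (L6).

References: vocabulary [cite: IyengarTakahashi2014, Definition 2.1] (`ca`) only; the algebra is elementary.
-/

noncomputable section

set_option linter.dupNamespace false

open Summit.ResolutionOfSingularities.ResolutionOfSingularities.Theorems.NoZeno.Birth
open Summit.ResolutionOfSingularities.ResolutionOfSingularities.Theorems

namespace Summit.ResolutionOfSingularities.ResolutionOfSingularities.Theorems.HomologicalConductor.PersistenceKC3TowerInstance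

open Summit.ResolutionOfSingularities.ResolutionOfSingularities.Theorems.HomologicalConductor.PersistenceKC3Tower

variable {k K : Type} [Field k] [Field K] [Algebra k K]

/-! ## §1 Two generic complements -/

/-- An element of `loc O W` whose inverse lies in `O` is a unit of `loc O W` (`(a s⁻¹)⁻¹ = s · a⁻¹`, `a⁻¹ = (a s⁻¹)⁻¹ s⁻¹ ∈ O`).
[folklore] -/
theorem inv_mem_loc (O : ValuationSubring K) (W : Subalgebra k K) {w : K} (hw : w ∈ loc O W) (hwO : w⁻¹ ∈ O) :
    w⁻¹ ∈ loc O W := by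
  rw [mem_loc_iff] at hw ⊢
  obtain ⟨a, ha, s, hs, hsO, rfl⟩ := hw
  by_cases ha0 : a = 0
  · subst ha0
    exact ⟨0, W.zero_mem, 1, W.one_mem, by rw [inv_one]; exact O.one_mem, by simp⟩
  by_cases hs0 : s = 0
  · subst hs0
    exact ⟨0, W.zero_mem, 1, W.one_mem, by rw [inv_one]; exact O.one_mem, by simp⟩
  refine ⟨s, hs, a, ha, ?_, by rw [mul_inv, inv_inv, mul_comm]⟩
  have : a⁻¹ = (a * s⁻¹)⁻¹ * s⁻¹ := by field_simp
  rw [this]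
  exact O.mul_mem _ _ hwO hsO

/-- `W ⊆ O ⇒ loc O W ⊆ O`. [folklore] -/
theorem loc_subset_valuationSubring (O : ValuationSubring K) (W : Subalgebra k K) (hWO : (W : Set K) ⊆ O) :
    (loc O W : Set K) ⊆ O := by
  intro y hy
  rw [SetLike.mem_coe, mem_loc_iff] at hy
  obtain ⟨a, ha, s, _, hsO, rfl⟩ := hy
  exact O.mul_mem _ _ (hWO ha) hsO

/-! ## §2 The K-C3 rings `A = k[x, z, t, y]`, `y = (z³ + t⁴)/x`, and `W = k[x, z, t, z²/x, zt/x, t²/x, z³/x²]` inside `K` -/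

section KC3

variable (x z t : K)

/-- `A ≤ W`: `y = z·(z²/x) + t²·(t²/x)`. [folklore] -/
theorem adjoin_A_le_W :
    Algebra.adjoin k ({x, z, t, (z ^ 3 + t ^ 4) * x⁻¹} : Set K) ≤
      Algebra.adjoin k ({x, z, t, z ^ 2 * x⁻¹, z * t * x⁻¹, t ^ 2 * x⁻¹, z ^ 3 * x⁻¹ * x⁻¹} : Set K) := by
  set W := Algebra.adjoin k ({x, z, t, z ^ 2 * x⁻¹, z * t * x⁻¹, t ^ 2 * x⁻¹, z ^ 3 * x⁻¹ * x⁻¹} : Set K) with hW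
  have gx : x ∈ W := Algebra.subset_adjoin (by simp)
  have gz : z ∈ W := Algebra.subset_adjoin (by simp)
  have gt : t ∈ W := Algebra.subset_adjoin (by simp)
  have g1 : z ^ 2 * x⁻¹ ∈ W := Algebra.subset_adjoin (by simp)
  have g3 : t ^ 2 * x⁻¹ ∈ W := Algebra.subset_adjoin (by simp)
  rw [Algebra.adjoin_le_iff]
  rintro _ (rfl | rfl | rfl | rfl)
  · exact gx
  · exact gz
  · exact gt
  · have : (z ^ 3 + t ^ 4) * x⁻¹ = z * (z ^ 2 * x⁻¹) + t ^ 2 * (t ^ 2 * x⁻¹) := by ring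
    rw [SetLike.mem_coe, this]
    exact W.add_mem (W.mul_mem gz g1) (W.mul_mem (W.pow_mem gt 2) g3)

/-- The five generators of `I = (x, y, z², zt, t²)` divided by `x` lie in `W`. [folklore] -/
theorem gens_div_x_mem_W (hx : x ≠ 0) :
    x * x⁻¹ ∈ Algebra.adjoin k ({x, z, t, z ^ 2 * x⁻¹, z * t * x⁻¹, t ^ 2 * x⁻¹, z ^ 3 * x⁻¹ * x⁻¹} : Set K) ∧
    (z ^ 3 + t ^ 4) * x⁻¹ * x⁻¹ ∈
      Algebra.adjoin k ({x, z, t, z ^ 2 * x⁻¹, z * t * x⁻¹, t ^ 2 * x⁻¹, z ^ 3 * x⁻¹ * x⁻¹} : Set K) ∧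
    z ^ 2 * x⁻¹ ∈ Algebra.adjoin k ({x, z, t, z ^ 2 * x⁻¹, z * t * x⁻¹, t ^ 2 * x⁻¹, z ^ 3 * x⁻¹ * x⁻¹} : Set K) ∧
    z * t * x⁻¹ ∈ Algebra.adjoin k ({x, z, t, z ^ 2 * x⁻¹, z * t * x⁻¹, t ^ 2 * x⁻¹, z ^ 3 * x⁻¹ * x⁻¹} : Set K) ∧
    t ^ 2 * x⁻¹ ∈ Algebra.adjoin k ({x, z, t, z ^ 2 * x⁻¹, z * t * x⁻¹, t ^ 2 * x⁻¹, z ^ 3 * x⁻¹ * x⁻¹} : Set K) := by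
  set W := Algebra.adjoin k ({x, z, t, z ^ 2 * x⁻¹, z * t * x⁻¹, t ^ 2 * x⁻¹, z ^ 3 * x⁻¹ * x⁻¹} : Set K) with hW
  have g3 : t ^ 2 * x⁻¹ ∈ W := Algebra.subset_adjoin (by simp)
  have g4 : z ^ 3 * x⁻¹ * x⁻¹ ∈ W := Algebra.subset_adjoin (by simp)
  refine ⟨by rw [mul_inv_cancel₀ hx]; exact W.one_mem, ?_, Algebra.subset_adjoin (by simp), Algebra.subset_adjoin (by simp), g3⟩
  have : (z ^ 3 + t ^ 4) * x⁻¹ * x⁻¹ = z ^ 3 * x⁻¹ * x⁻¹ + (t ^ 2 * x⁻¹) * (t ^ 2 * x⁻¹) := by ring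
  rw [this]
  exact W.add_mem g4 (W.mul_mem g3 g3)

variable (O : ValuationSubring K)

/-- `I·T₀ ⊆ x · W_loc`: every `T₀`-combination `c` of `x, y, z², zt, t²` has `c · x⁻¹ ∈ loc O W`. [folklore] -/
theorem combination_div_x_mem_locW (hx : x ≠ 0) {α β γ δ ε : K}
    (hα : α ∈ loc O (Algebra.adjoin k ({x, z, t, (z ^ 3 + t ^ 4) * x⁻¹} : Set K)))
    (hβ : β ∈ loc O (Algebra.adjoin k ({x, z, t, (z ^ 3 + t ^ 4) * x⁻¹} : Set K)))
    (hγ : γ ∈ loc O (Algebra.adjoin k ({x, z, t, (z ^ 3 + t ^ 4) * x⁻¹} : Set K)))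
    (hδ : δ ∈ loc O (Algebra.adjoin k ({x, z, t, (z ^ 3 + t ^ 4) * x⁻¹} : Set K)))
    (hε : ε ∈ loc O (Algebra.adjoin k ({x, z, t, (z ^ 3 + t ^ 4) * x⁻¹} : Set K))) :
    (α * x + β * ((z ^ 3 + t ^ 4) * x⁻¹) + γ * z ^ 2 + δ * (z * t) + ε * t ^ 2) * x⁻¹ ∈
      loc O (Algebra.adjoin k ({x, z, t, z ^ 2 * x⁻¹, z * t * x⁻¹, t ^ 2 * x⁻¹, z ^ 3 * x⁻¹ * x⁻¹} : Set K)) := by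
  set W := Algebra.adjoin k ({x, z, t, z ^ 2 * x⁻¹, z * t * x⁻¹, t ^ 2 * x⁻¹, z ^ 3 * x⁻¹ * x⁻¹} : Set K) with hW
  have hTW : loc O (Algebra.adjoin k ({x, z, t, (z ^ 3 + t ^ 4) * x⁻¹} : Set K)) ≤ loc O W := by
    rw [loc_eq_locAt, loc_eq_locAt]
    exact SyzygyFlattening.locAt_mono O (adjoin_A_le_W x z t)
  have hWl : W ≤ loc O W := fun b hb =>
    Algebra.subset_adjoin ⟨b, hb, 1, W.one_mem, by rw [inv_one]; exact O.one_mem, by rw [inv_one, mul_one]⟩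
  obtain ⟨g0, g1, g2, g3, g4⟩ := gens_div_x_mem_W (k := k) x z t hx
  have : (α * x + β * ((z ^ 3 + t ^ 4) * x⁻¹) + γ * z ^ 2 + δ * (z * t) + ε * t ^ 2) * x⁻¹ =
      α * (x * x⁻¹) + β * ((z ^ 3 + t ^ 4) * x⁻¹ * x⁻¹) + γ * (z ^ 2 * x⁻¹) + δ * (z * t * x⁻¹) + ε * (t ^ 2 * x⁻¹) := by
    ring
  rw [this]
  refine (loc O W).add_mem ((loc O W).add_mem ((loc O W).add_mem ((loc O W).add_mem ?_ ?_) ?_) ?_) ?_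
  · exact (loc O W).mul_mem (hTW hα) (hWl g0)
  · exact (loc O W).mul_mem (hTW hβ) (hWl g1)
  · exact (loc O W).mul_mem (hTW hγ) (hWl g2)
  · exact (loc O W).mul_mem (hTW hδ) (hWl g3)
  · exact (loc O W).mul_mem (hTW hε) (hWl g4)

/-- **`W ≤ chart O T₀`** (REFEREE-KC3 L4, lower half): given `ca T₀ = I·T₀` and `W ⊆ O`, the element `x` is a nonzero element of
`ca T₀` of minimal value (`c′ · x⁻¹ ∈ O` for all `c′ ∈ ca T₀`), so the chart adjoins `y/x, z²/x, zt/x, t²/x`, and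
`z³/x² = y/x − (t²/x)²`. [folklore] -/
theorem W_le_chart (hx : x ≠ 0)
    (hWO : (Algebra.adjoin k ({x, z, t, z ^ 2 * x⁻¹, z * t * x⁻¹, t ^ 2 * x⁻¹, z ^ 3 * x⁻¹ * x⁻¹} : Set K) : Set K) ⊆ O)
    (hca : ca (loc O (Algebra.adjoin k ({x, z, t, (z ^ 3 + t ^ 4) * x⁻¹} : Set K))) =
      {c : K | ∃ α β γ δ ε : K, α ∈ loc O (Algebra.adjoin k ({x, z, t, (z ^ 3 + t ^ 4) * x⁻¹} : Set K)) ∧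
        β ∈ loc O (Algebra.adjoin k ({x, z, t, (z ^ 3 + t ^ 4) * x⁻¹} : Set K)) ∧
        γ ∈ loc O (Algebra.adjoin k ({x, z, t, (z ^ 3 + t ^ 4) * x⁻¹} : Set K)) ∧
        δ ∈ loc O (Algebra.adjoin k ({x, z, t, (z ^ 3 + t ^ 4) * x⁻¹} : Set K)) ∧
        ε ∈ loc O (Algebra.adjoin k ({x, z, t, (z ^ 3 + t ^ 4) * x⁻¹} : Set K)) ∧
        c = α * x + β * ((z ^ 3 + t ^ 4) * x⁻¹) + γ * z ^ 2 + δ * (z * t) + ε * t ^ 2}) :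
    Algebra.adjoin k ({x, z, t, z ^ 2 * x⁻¹, z * t * x⁻¹, t ^ 2 * x⁻¹, z ^ 3 * x⁻¹ * x⁻¹} : Set K) ≤
      chart O (loc O (Algebra.adjoin k ({x, z, t, (z ^ 3 + t ^ 4) * x⁻¹} : Set K))) := by
  set A := Algebra.adjoin k ({x, z, t, (z ^ 3 + t ^ 4) * x⁻¹} : Set K) with hA
  set W := Algebra.adjoin k ({x, z, t, z ^ 2 * x⁻¹, z * t * x⁻¹, t ^ 2 * x⁻¹, z ^ 3 * x⁻¹ * x⁻¹} : Set K) with hW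
  set T := loc O A with hT
  have hAT : A ≤ T := fun b hb =>
    Algebra.subset_adjoin ⟨b, hb, 1, A.one_mem, by rw [inv_one]; exact O.one_mem, by rw [inv_one, mul_one]⟩
  have hTc : T ≤ chart O T := fun b hb => Algebra.subset_adjoin (Or.inl hb)
  -- membership of the five generators of `I` in `ca T`
  have mem_ca : ∀ {α β γ δ ε : K}, α ∈ T → β ∈ T → γ ∈ T → δ ∈ T → ε ∈ T →
      α * x + β * ((z ^ 3 + t ^ 4) * x⁻¹) + γ * z ^ 2 + δ * (z * t) + ε * t ^ 2 ∈ ca T := by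
    intro α β γ δ ε hα hβ hγ hδ hε
    rw [hca]
    exact ⟨α, β, γ, δ, ε, hα, hβ, hγ, hδ, hε, rfl⟩
  have hxca : x ∈ ca T := by
    have := mem_ca T.one_mem T.zero_mem T.zero_mem T.zero_mem T.zero_mem
    simpa using this
  have hyca : (z ^ 3 + t ^ 4) * x⁻¹ ∈ ca T := by
    have := mem_ca T.zero_mem T.one_mem T.zero_mem T.zero_mem T.zero_mem
    simpa using this
  have hz2ca : z ^ 2 ∈ ca T := by
    have := mem_ca T.zero_mem T.zero_mem T.one_mem T.zero_mem T.zero_mem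
    simpa using this
  have hztca : z * t ∈ ca T := by
    have := mem_ca T.zero_mem T.zero_mem T.zero_mem T.one_mem T.zero_mem
    simpa using this
  have ht2ca : t ^ 2 ∈ ca T := by
    have := mem_ca T.zero_mem T.zero_mem T.zero_mem T.zero_mem T.one_mem
    simpa using this
  -- `x` has minimal value: `c′ · x⁻¹ ∈ loc O W ⊆ O`
  have hq : ∀ c' ∈ ca T, c' * x⁻¹ ∈ O := by
    intro c' hc'
    rw [hca] at hc'
    obtain ⟨α, β, γ, δ, ε, hα, hβ, hγ, hδ, hε, rfl⟩ := hc'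
    exact loc_subset_valuationSubring O W hWO (combination_div_x_mem_locW x z t O hx hα hβ hγ hδ hε)
  have gen : ∀ c ∈ ca T, c * x⁻¹ ∈ chart O T := fun c hc =>
    Algebra.subset_adjoin (Or.inr ⟨c, hc, x, hxca, hx, hq, rfl⟩)
  rw [Algebra.adjoin_le_iff]
  rintro _ (rfl | rfl | rfl | rfl | rfl | rfl | rfl)
  · exact hTc (hAT (Algebra.subset_adjoin (by simp)))
  · exact hTc (hAT (Algebra.subset_adjoin (by simp)))
  · exact hTc (hAT (Algebra.subset_adjoin (by simp)))
  · exact gen _ hz2ca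
  · exact gen _ hztca
  · exact gen _ ht2ca
  · have : z ^ 3 * x⁻¹ * x⁻¹ = (z ^ 3 + t ^ 4) * x⁻¹ * x⁻¹ - (t ^ 2 * x⁻¹) * (t ^ 2 * x⁻¹) := by ring
    rw [SetLike.mem_coe, this]
    exact (chart O T).sub_mem (gen _ hyca) ((chart O T).mul_mem (gen _ ht2ca) (gen _ ht2ca))

/-- **`chart O T₀ ≤ loc O W`** (REFEREE-KC3 L3 + L4, upper half): a qualifying `x′` (`x′ ∈ ca T₀`, `x′ ≠ 0`, all `c′ x′⁻¹ ∈ O`) is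
`x · w′` with `w′ = x′ x⁻¹ ∈ loc O W` and `w′⁻¹ = x x′⁻¹ ∈ O`, hence `w′⁻¹ ∈ loc O W`; and `c x′⁻¹ = (c x⁻¹) · w′⁻¹`. [folklore] -/
theorem chart_le_locW (hx : x ≠ 0)
    (hca : ca (loc O (Algebra.adjoin k ({x, z, t, (z ^ 3 + t ^ 4) * x⁻¹} : Set K))) =
      {c : K | ∃ α β γ δ ε : K, α ∈ loc O (Algebra.adjoin k ({x, z, t, (z ^ 3 + t ^ 4) * x⁻¹} : Set K)) ∧
        β ∈ loc O (Algebra.adjoin k ({x, z, t, (z ^ 3 + t ^ 4) * x⁻¹} : Set K)) ∧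
        γ ∈ loc O (Algebra.adjoin k ({x, z, t, (z ^ 3 + t ^ 4) * x⁻¹} : Set K)) ∧
        δ ∈ loc O (Algebra.adjoin k ({x, z, t, (z ^ 3 + t ^ 4) * x⁻¹} : Set K)) ∧
        ε ∈ loc O (Algebra.adjoin k ({x, z, t, (z ^ 3 + t ^ 4) * x⁻¹} : Set K)) ∧
        c = α * x + β * ((z ^ 3 + t ^ 4) * x⁻¹) + γ * z ^ 2 + δ * (z * t) + ε * t ^ 2}) :
    chart O (loc O (Algebra.adjoin k ({x, z, t, (z ^ 3 + t ^ 4) * x⁻¹} : Set K))) ≤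
      loc O (Algebra.adjoin k ({x, z, t, z ^ 2 * x⁻¹, z * t * x⁻¹, t ^ 2 * x⁻¹, z ^ 3 * x⁻¹ * x⁻¹} : Set K)) := by
  set A := Algebra.adjoin k ({x, z, t, (z ^ 3 + t ^ 4) * x⁻¹} : Set K) with hA
  set W := Algebra.adjoin k ({x, z, t, z ^ 2 * x⁻¹, z * t * x⁻¹, t ^ 2 * x⁻¹, z ^ 3 * x⁻¹ * x⁻¹} : Set K) with hW
  set T := loc O A with hT
  have hTW : T ≤ loc O W := by
    rw [hT, loc_eq_locAt, loc_eq_locAt]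
    exact SyzygyFlattening.locAt_mono O (adjoin_A_le_W x z t)
  have hxca : x ∈ ca T := by
    rw [hca]
    exact ⟨1, 0, 0, 0, 0, T.one_mem, T.zero_mem, T.zero_mem, T.zero_mem, T.zero_mem, by ring⟩
  have hdiv : ∀ c ∈ ca T, c * x⁻¹ ∈ loc O W := by
    intro c hc
    rw [hca] at hc
    obtain ⟨α, β, γ, δ, ε, hα, hβ, hγ, hδ, hε, rfl⟩ := hc
    exact combination_div_x_mem_locW x z t O hx hα hβ hγ hδ hε
  change Algebra.adjoin k _ ≤ _
  rw [Algebra.adjoin_le_iff]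
  rintro y (hy | ⟨c, hc, x', hx', hx'0, hq, rfl⟩)
  · exact hTW hy
  · have hw' : x' * x⁻¹ ∈ loc O W := hdiv x' hx'
    have hw'inv : (x' * x⁻¹)⁻¹ ∈ loc O W := by
      refine inv_mem_loc O W hw' ?_
      rw [mul_inv, inv_inv, mul_comm]
      exact hq x hxca
    have : c * x'⁻¹ = (c * x⁻¹) * (x' * x⁻¹)⁻¹ := by field_simp
    rw [SetLike.mem_coe, this]
    exact (loc O W).mul_mem (hdiv c hc) hw'inv

/-- **THE K-C3 TOWER STEP** (REFEREE-KC3 934cc3b7642bc99f L3–L6): for nonzero `x, z, t ∈ K`, `A = k[x, z, t, (z³+t⁴)/x]`,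
`W = k[x, z, t, z²/x, zt/x, t²/x, z³/x²] ⊆ O`, if `ca (loc O A)` is the ideal `(x, y, z², zt, t²)·loc O A` (F-DP + U2, conditional
on print lower/upper bounds — a HYPOTHESIS here) and `loc O W` is integrally closed in `K` (normality of the μ₆(1,2,3)-quotient chart
— a HYPOTHESIS here), then `tower O A 1 = loc O W`. [folklore] -/
theorem kc3_tower_one_eq (hx : x ≠ 0)
    (hWO : (Algebra.adjoin k ({x, z, t, z ^ 2 * x⁻¹, z * t * x⁻¹, t ^ 2 * x⁻¹, z ^ 3 * x⁻¹ * x⁻¹} : Set K) : Set K) ⊆ O)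
    (hca : ca (loc O (Algebra.adjoin k ({x, z, t, (z ^ 3 + t ^ 4) * x⁻¹} : Set K))) =
      {c : K | ∃ α β γ δ ε : K, α ∈ loc O (Algebra.adjoin k ({x, z, t, (z ^ 3 + t ^ 4) * x⁻¹} : Set K)) ∧
        β ∈ loc O (Algebra.adjoin k ({x, z, t, (z ^ 3 + t ^ 4) * x⁻¹} : Set K)) ∧
        γ ∈ loc O (Algebra.adjoin k ({x, z, t, (z ^ 3 + t ^ 4) * x⁻¹} : Set K)) ∧
        δ ∈ loc O (Algebra.adjoin k ({x, z, t, (z ^ 3 + t ^ 4) * x⁻¹} : Set K)) ∧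
        ε ∈ loc O (Algebra.adjoin k ({x, z, t, (z ^ 3 + t ^ 4) * x⁻¹} : Set K)) ∧
        c = α * x + β * ((z ^ 3 + t ^ 4) * x⁻¹) + γ * z ^ 2 + δ * (z * t) + ε * t ^ 2})
    (hnrm : nrm (loc O (Algebra.adjoin k ({x, z, t, z ^ 2 * x⁻¹, z * t * x⁻¹, t ^ 2 * x⁻¹, z ^ 3 * x⁻¹ * x⁻¹} : Set K))) ≤
      loc O (Algebra.adjoin k ({x, z, t, z ^ 2 * x⁻¹, z * t * x⁻¹, t ^ 2 * x⁻¹, z ^ 3 * x⁻¹ * x⁻¹} : Set K))) :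
    tower O (Algebra.adjoin k ({x, z, t, (z ^ 3 + t ^ 4) * x⁻¹} : Set K)) 1 =
      loc O (Algebra.adjoin k ({x, z, t, z ^ 2 * x⁻¹, z * t * x⁻¹, t ^ 2 * x⁻¹, z ^ 3 * x⁻¹ * x⁻¹} : Set K)) :=
  tower_one_eq_loc_of_sandwich O _ _ (W_le_chart x z t O hx hWO hca) (chart_le_locW x z t O hx hca) hnrm

end KC3

end Summit.ResolutionOfSingularities.ResolutionOfSingularities.Theorems.HomologicalConductor.PersistenceKC3TowerInstance

end
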